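import Literature.NumberTheory.GaloisRepresentations.ConjugationDescent
import Literature.NumberTheory.GaloisRepresentations.TateDualityCounting
import Literature.NumberTheory.GaloisRepresentations.CyclicIndexEulerChar
import Mathlib.RepresentationTheory.Intertwining
import HarnessLib

/-!
# Representation-theoretic glue for the tame-layer Euler–Poincaré characteristic
# (cell `b2b-bsdres`, team n1011, row T-EPC = Tate's local Euler–Poincaré characteristic; seat p04 GEN 8; stage C4a)

HONEST FRAMING (cell `b2b-bsdres`, run/shared/lean/b2b/bsd-rank1-residual/, verbatim in every
file): the goal of the cell is to DELETE the COMBINATION-SHAPED residual classes of the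
Birch–Swinnerton-Dyer formula for ALL analytic-rank `≤ 1` elliptic curves over `ℚ` — "full BSD
formula for every rank `≤ 1` curve in class `C`" assembled STRICTLY from published theorems — so
that the rank-`≤ 1` remainder becomes exactly the CONSTRUCTION-SHAPED classes, which are TYPED
(missing-input `Prop`s), NOT attempted. This is not "finishing BSD". Team n1011 (N10 / N11, the
additive block X4 ∧ `p = 3`): research route; no claim beyond the stated classes; nothing is
booked; no mark / label is changed by this file. Theorems only (no definition, no named fact, no
`sorry`); TOOL theorems (bookkeeping of representations).  (Placement: Summits/GaloisImage with the
T-EPC cone.)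

## What

Bookkeeping used to plug stages C1–C3 (cohomology of the tame subgroup) into stage B7 (Milne's
Lemma 2.11, which is stated for the finite group `Gal(E/K)`), all elementary:

* `EPCGlue.natCard_invariantCocycles_congr` — the number of `G`-invariant continuous `1`-cocycles of
  a normal subgroup `N` is invariant under isomorphisms of topological `G`-modules (used with the
  tree's `biDualIso : M ≅ M^{DD}`);
* `EPCGlue.natCard_intertwiningMap_congr_of_eq` — `#Hom_G` only depends on the actions as functions;
* `EPCGlue.natCard_intertwiningMap_comp_of_surjective`, `exists_representation_comp_eq`,
  `natCard_invariants_comp_of_surjective` — representations trivial on `ker π` descend along a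
  surjection `π : G → H`, with the same intertwining maps and invariants;
* `EPCGlue.natCard_intertwiningMap_eq_natCard_invariants_homRep` —
  `#Hom_G(Z, Ω) = #(Hom(Z, Ω))^G` for the tree's dual module `homRep`.

References: J. S. Milne, *Arithmetic Duality Theorems* (2006), I §0, I §2 [MilneADT2006];
J.-P. Serre, *Local Fields* (1979), VII §5 [SerreLocalFields1979].
-/

noncomputable section

open CategoryTheory Function
open Literature.NumberTheory.GaloisRepresentations
open Literature.NumberTheory.EllipticCurves (subgroupConj subgroupConj_apply_coe)

universe u

namespace Summit.BirchSwinnertonDyer.Rank1Residual.GaloisImage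

namespace EPCGlue

/-! ### Invariant cocycles along an isomorphism of topological modules -/

section Cocycles

variable {G : Type u} [Group G] [TopologicalSpace G] [IsTopologicalGroup G]
variable (N : Subgroup G) [N.Normal]
variable {M₁ : Type u} [AddCommGroup M₁] [TopologicalSpace M₁] [DiscreteTopology M₁]
variable {M₂ : Type u} [AddCommGroup M₂] [TopologicalSpace M₂] [DiscreteTopology M₂]
variable {ρ₁ : ContinuousRep G ℤ M₁} {ρ₂ : ContinuousRep G ℤ M₂}

omit [IsTopologicalGroup G] [N.Normal] in
/-- Push-forward of a continuous cocycle of `N` along a morphism of topological `G`-modules.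
[folklore] -/
theorem exists_map_cocycle (f : ρ₁.toTopRep ⟶ ρ₂.toTopRep)
    (φ : contOneCocycles (subgroupRep ρ₁.toTopRep N)) :
    ∃ ψ : contOneCocycles (subgroupRep ρ₂.toTopRep N), ∀ m : N, ψ.1 m = f.hom (φ.1 m) := by
  refine ⟨⟨(f.hom : C(M₁, M₂)).comp φ.1, fun m m' => ?_⟩, fun m => rfl⟩
  change f.hom (φ.1 (m * m')) = f.hom (φ.1 m) + ρ₂ (m : G) (f.hom (φ.1 m'))
  rw [φ.2 m m', map_add, subgroupRep_ρ_apply]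
  change f.hom (φ.1 m) + f.hom (ρ₁ (m : G) (φ.1 m')) = _
  rw [ContinuousRep.hom_comm_apply]

/-- **`#{G-invariant cocycles of N}` is invariant under isomorphisms of topological `G`-modules.**
[folklore] -/
theorem natCard_invariantCocycles_congr (e : ρ₁.toTopRep ≅ ρ₂.toTopRep) :
    Nat.card {φ : contOneCocycles (subgroupRep ρ₁.toTopRep N) //
        ∀ g : G, contOneCocycles.pullback (subgroupConj N g) (conjRepHom ρ₁.toTopRep N g) φ = φ} =
      Nat.card {φ : contOneCocycles (subgroupRep ρ₂.toTopRep N) //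
        ∀ g : G, contOneCocycles.pullback (subgroupConj N g) (conjRepHom ρ₂.toTopRep N g) φ = φ} := by
  classical
  choose F hF using exists_map_cocycle N e.hom
  choose B hB using exists_map_cocycle N e.inv
  have hBF : ∀ φ, B (F φ) = φ := fun φ => by
    apply Subtype.ext; ext m
    rw [hB, hF, ← TopRep.comp_apply, e.hom_inv_id, TopRep.id_apply]
  have hFB : ∀ ψ, F (B ψ) = ψ := fun ψ => by
    apply Subtype.ext; ext m
    rw [hF, hB, ← TopRep.comp_apply, e.inv_hom_id, TopRep.id_apply]
  -- compatibility with conjugation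
  have hconjF : ∀ (g : G) (φ : contOneCocycles (subgroupRep ρ₁.toTopRep N)),
      contOneCocycles.pullback (subgroupConj N g) (conjRepHom ρ₂.toTopRep N g) (F φ) =
        F (contOneCocycles.pullback (subgroupConj N g) (conjRepHom ρ₁.toTopRep N g) φ) := fun g φ => by
    apply Subtype.ext; ext m
    rw [conj_pullback_apply, hF, hF, conj_pullback_apply]
    change ρ₂ g (e.hom.hom _) = e.hom.hom (ρ₁ g _)
    rw [ContinuousRep.hom_comm_apply]
  have hconjB : ∀ (g : G) (ψ : contOneCocycles (subgroupRep ρ₂.toTopRep N)),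
      contOneCocycles.pullback (subgroupConj N g) (conjRepHom ρ₁.toTopRep N g) (B ψ) =
        B (contOneCocycles.pullback (subgroupConj N g) (conjRepHom ρ₂.toTopRep N g) ψ) := fun g ψ => by
    apply Subtype.ext; ext m
    rw [conj_pullback_apply, hB, hB, conj_pullback_apply]
    change ρ₁ g (e.inv.hom _) = e.inv.hom (ρ₂ g _)
    rw [ContinuousRep.hom_comm_apply]
  refine Nat.card_congr
    { toFun := fun φ => ⟨F φ.1, fun g => by rw [hconjF, φ.2 g]⟩
      invFun := fun ψ => ⟨B ψ.1, fun g => by rw [hconjB, ψ.2 g]⟩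
      left_inv := fun φ => Subtype.ext (hBF φ.1)
      right_inv := fun ψ => Subtype.ext (hFB ψ.1) }

end Cocycles

/-! ### Intertwining maps and invariants only depend on the actions -/

section Intertwining

variable {G : Type*} [Group G]
variable {Z : Type*} [AddCommGroup Z] [Module ℤ Z] {Y : Type*} [AddCommGroup Y] [Module ℤ Y]

/-- `#Hom_G(Z, Y)` only depends on the actions as functions. [folklore] -/
theorem natCard_intertwiningMap_congr_of_eq {σ₁ σ₂ : Representation ℤ G Z} {τ₁ τ₂ : Representation ℤ G Y}
    (hσ : ∀ g z, σ₁ g z = σ₂ g z) (hτ : ∀ g y, τ₁ g y = τ₂ g y) :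
    Nat.card (Representation.IntertwiningMap σ₁ τ₁) = Nat.card (Representation.IntertwiningMap σ₂ τ₂) := by
  refine Nat.card_congr
    { toFun := fun f => f.toLinearMap.intertwiningMap_of_isIntertwiningMap σ₂ τ₂ fun g z => by
        rw [← hσ, ← hτ]; exact f.isIntertwining σ₁ τ₁ g z
      invFun := fun f => f.toLinearMap.intertwiningMap_of_isIntertwiningMap σ₁ τ₁ fun g z => by
        rw [hσ, hτ]; exact f.isIntertwining σ₂ τ₂ g z
      left_inv := fun f => Representation.IntertwiningMap.ext rfl
      right_inv := fun f => Representation.IntertwiningMap.ext rfl }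

variable {H : Type*} [Group H]

/-- **Intertwining maps along a surjection**: for `π : G → H` onto, `Hom_G(π^*Z, π^*Y) = Hom_H(Z, Y)`
(same underlying additive maps). [folklore] -/
theorem natCard_intertwiningMap_comp_of_surjective (π : G →* H) (hπ : Surjective π)
    (σ : Representation ℤ H Z) (τ : Representation ℤ H Y) :
    Nat.card (Representation.IntertwiningMap (σ.comp π) (τ.comp π)) =
      Nat.card (Representation.IntertwiningMap σ τ) := by
  refine Nat.card_congr
    { toFun := fun f => f.toLinearMap.intertwiningMap_of_isIntertwiningMap σ τ fun h z => by
        obtain ⟨g, rfl⟩ := hπ h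
        exact f.isIntertwining (σ.comp π) (τ.comp π) g z
      invFun := fun f => f.toLinearMap.intertwiningMap_of_isIntertwiningMap (σ.comp π) (τ.comp π)
        fun g z => f.isIntertwining σ τ (π g) z
      left_inv := fun f => Representation.IntertwiningMap.ext rfl
      right_inv := fun f => Representation.IntertwiningMap.ext rfl }

/-- **Descent along a surjection**: a representation of `G` on which `ker π` acts trivially is
pulled back from a (unique) representation of `H`. [folklore] -/
theorem exists_representation_comp_eq (π : G →* H) (hπ : Surjective π) (σ : Representation ℤ G Z)
    (hker : ∀ g, π g = 1 → ∀ z, σ g z = z) :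
    ∃ σ' : Representation ℤ H Z, ∀ g z, σ' (π g) z = σ g z := by
  -- `σ` is constant on the fibres of `π`
  have hfib : ∀ g g' : G, π g = π g' → σ g = σ g' := fun g g' h => by
    have h1 : π (g⁻¹ * g') = 1 := by rw [map_mul, map_inv, h, inv_mul_cancel]
    have h2 : σ (g⁻¹ * g') = 1 := LinearMap.ext fun z => hker _ h1 z
    calc σ g = σ g * σ (g⁻¹ * g') := by rw [h2, mul_one]
      _ = σ g' := by rw [← map_mul, mul_inv_cancel_left]
  let s := Function.surjInv hπ
  have hs : ∀ h, π (s h) = h := Function.surjInv_eq hπ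
  refine ⟨{ toFun := fun h => σ (s h)
            map_one' := by rw [hfib (s 1) 1 (by rw [hs, map_one]), map_one]
            map_mul' := fun h h' => by
              rw [hfib (s (h * h')) (s h * s h') (by rw [hs, map_mul, hs, hs]), map_mul] },
    fun g z => ?_⟩
  change σ (s (π g)) z = σ g z
  rw [hfib (s (π g)) g (hs _)]

/-- Invariants along a surjection: `(π^*Z)^G = Z^H`. [folklore] -/
theorem natCard_invariants_comp_of_surjective (π : G →* H) (hπ : Surjective π)
    (σ : Representation ℤ H Z) :
    Nat.card (Representation.invariants (σ.comp π)) = Nat.card σ.invariants := by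
  refine Nat.card_congr
    { toFun := fun z => ⟨z.1, fun h => by obtain ⟨g, rfl⟩ := hπ h; exact z.2 g⟩
      invFun := fun z => ⟨z.1, fun g => z.2 (π g)⟩
      left_inv := fun z => rfl
      right_inv := fun z => rfl }

end Intertwining

/-! ### `Hom_G(Z, Ω) = (Z^D)^G` -/

section HomRep

variable {G : Type u} [Group G] [TopologicalSpace G] [IsTopologicalGroup G]
variable {Z : Type u} [AddCommGroup Z] [TopologicalSpace Z] [DiscreteTopology Z] [Finite Z]
variable {Ω : Type u} [AddCommGroup Ω] [TopologicalSpace Ω] [DiscreteTopology Ω]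
variable (ζ : ContinuousRep G ℤ Z) (ω : ContinuousRep G ℤ Ω)

/-- **`#Hom_G(Z, Ω) = #(Hom(Z, Ω))^G`** for the tree's dual module `Z^D = homRep ζ ω`
(an additive map is equivariant iff it is a `G`-fixed element of `Z^D`). [cite: MilneADT2006, I §0] -/
theorem natCard_intertwiningMap_eq_natCard_invariants_homRep :
    Nat.card (Representation.IntertwiningMap ζ.toRepresentation ω.toRepresentation) =
      Nat.card (ζ.homRep ω).toTopRep.ρ.invariants := by
  refine Nat.card_congr
    { toFun := fun f => ⟨HomCarrier.ofAddMonoidHom f.toLinearMap.toAddMonoidHom, fun g => by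
        change (ζ.homRep ω) g _ = _
        rw [ContinuousRep.homRep_apply_eq_self_iff]
        intro z
        exact (f.isIntertwining ζ.toRepresentation ω.toRepresentation g z).symm⟩
      invFun := fun F => ((F.1 : Z →+ Ω).toIntLinearMap).intertwiningMap_of_isIntertwiningMap
        ζ.toRepresentation ω.toRepresentation fun g z => by
          have h := F.2 g
          change (ζ.homRep ω) g F.1 = F.1 at h
          rw [ContinuousRep.homRep_apply_eq_self_iff] at h
          exact (h z).symm
      left_inv := fun f => Representation.IntertwiningMap.ext rfl
      right_inv := fun F => Subtype.ext (HomCarrier.ext fun z => rfl) }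

omit [IsTopologicalGroup G] [Finite Z] in
/-- **`#Z^G` is invariant under isomorphisms of topological `G`-modules** (counted form of the tree's
`invariantsEquivOfIso`). [folklore] -/
theorem natCard_invariants_congr {M₂ : Type u} [AddCommGroup M₂] [TopologicalSpace M₂] [DiscreteTopology M₂]
    {ρ₂ : ContinuousRep G ℤ M₂} (e : ζ.toTopRep ≅ ρ₂.toTopRep) :
    Nat.card ζ.toTopRep.ρ.invariants = Nat.card ρ₂.toTopRep.ρ.invariants :=
  Nat.card_congr (invariantsEquivOfIso e)

end HomRep

end EPCGlue

end Summit.BirchSwinnertonDyer.Rank1Residual.GaloisImage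

end
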